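/-
Copyright: rh-split cell (screw, bridge) gen 15, 2026-08-27.  Splitting search over kernel-typed
RH-equivalences; this module is ζ-free analysis.  Nothing here bears on the truth of RH.
-/
import Summits.RiemannHypothesis.RiemannHypothesis.Theorems.Splittings.ScrewBorelFluxA
import HarnessLib

/-!
# Flux through thin walls — part B: the circles theorem, good radii, thin walls are transparent, scales

Continuation of `ScrewBorelFluxA` (same namespace `…Splittings.ScrewBorelFlux`; see its module docstring for
the statement and proof outline of `false_of_small_circles` and `poleSet_eq_empty_of_hausdorffMeasure_zero`).
No `sorry`, no new axioms, no instances, no notation.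
-/

set_option linter.dupNamespace false

namespace Summit.RiemannHypothesis.RiemannHypothesis.Theorems.Splittings.ScrewBorelFlux

open Complex Filter Topology Set Metric MeasureTheory
open scoped Real ENNReal NNReal
open Summit.RiemannHypothesis.RiemannHypothesis.Theorems.Splittings.ScrewBorel

/-! ## 4. The circles theorem -/

/-- Identity theorem on a preconnected set `V ∋ 0` inside `𝔻 ∖ closure (poleSet u)`: `F = B` on `V`. -/
theorem eqOn_of_preconnected {ι : Type*} {c u : ι → ℂ} (hc : Summable fun i ↦ ‖c i‖)
    (hu : ∀ i, u i ≠ 0) {F : ℂ → ℂ} (hF : DifferentiableOn ℂ F (ball 0 1)) {r₀ : ℝ} (hr₀ : 0 < r₀)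
    (hFB : EqOn F (fun z ↦ ∑' i, term (c i) (u i) z) (ball 0 r₀)) {V : Set ℂ}
    (hV : IsPreconnected V) (hV0 : (0 : ℂ) ∈ V) (hVsub : V ⊆ ball 0 1 \ closure (poleSet u)) :
    EqOn F (fun z ↦ ∑' i, term (c i) (u i) z) V := by
  have hVopen : IsOpen (ball (0 : ℂ) 1 \ closure (poleSet u)) := isOpen_ball.sdiff isClosed_closure
  have hFan : AnalyticOnNhd ℂ F V := ((hF.mono Set.sdiff_subset).analyticOnNhd hVopen).mono hVsub
  have hBan : AnalyticOnNhd ℂ (fun z ↦ ∑' i, term (c i) (u i) z) V :=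
    ((differentiableOn_borel hc hu).analyticOnNhd hVopen).mono hVsub
  have hev : F =ᶠ[𝓝 0] fun z ↦ ∑' i, term (c i) (u i) z :=
    Filter.eventuallyEq_of_mem (ball_mem_nhds 0 hr₀) hFB
  exact hFan.eqOn_of_preconnected_of_eventuallyEq hBan hV hV0 hev

/-- A compact set disjoint from `closure S` is uniformly separated from `S`. -/
theorem exists_separation {K S : Set ℂ} (hK : IsCompact K) (hKS : Disjoint K (closure S)) :
    ∃ δ > 0, ∀ z ∈ K, ∀ q ∈ S, δ ≤ ‖q - z‖ := by
  rcases S.eq_empty_or_nonempty with rfl | hS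
  · exact ⟨1, one_pos, fun z _ q hq ↦ (Set.notMem_empty q hq).elim⟩
  rcases K.eq_empty_or_nonempty with rfl | hKne
  · exact ⟨1, one_pos, fun z hz ↦ (Set.notMem_empty z hz).elim⟩
  obtain ⟨z₀, hz₀K, hz₀⟩ := hK.exists_isMinOn hKne (continuous_infDist_pt (s := S)).continuousOn
  have hpos : 0 < infDist z₀ S :=
    (infDist_pos_iff_notMem_closure hS).1 (Set.disjoint_left.1 hKS hz₀K)
  refine ⟨infDist z₀ S, hpos, fun z hz q hq ↦ ?_⟩
  calc infDist z₀ S ≤ infDist z S := hz₀ hz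
    _ ≤ dist z q := infDist_le_dist_of_mem hq
    _ = ‖q - z‖ := by rw [dist_comm, dist_eq_norm]

/-- Points of a sphere: `‖z‖ ≤ ‖x‖ + t` (file-internal copy; the landed twin is
`Literature.Analysis.OperatorTheory.norm_le_norm_add_of_mem_sphere`). -/
private theorem norm_le_of_mem_sphere {x z : ℂ} {t : ℝ} (hz : z ∈ sphere x t) :
    ‖z‖ ≤ ‖x‖ + t := by
  rw [mem_sphere, dist_eq_norm] at hz
  calc ‖z‖ = ‖x + (z - x)‖ := by congr 1; ring
    _ ≤ ‖x‖ + ‖z - x‖ := norm_add_le _ _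
    _ = ‖x‖ + t := by rw [hz]

/-- The index set of genuinely present terms is countable. -/
theorem countable_of_summable_of_re_neg {ι : Type*} {c : ι → ℂ} (hc : Summable fun i ↦ ‖c i‖)
    (hre : ∀ i, (c i).re < 0) : Countable ι := by
  have hsupp : (Function.support fun i ↦ ‖c i‖) = univ := by
    ext i
    simp only [Function.mem_support, mem_univ, iff_true, ne_eq, norm_eq_zero]
    intro h
    have := hre i
    rw [h, Complex.zero_re] at this
    exact lt_irrefl _ this
  have h := hc.countable_support
  rw [hsupp] at h
  exact Set.countable_univ_iff.1 h

/-- The total pole coefficient at an inside pole has negative real part. -/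
theorem re_tsum_poleCoeff_neg {ι : Type*} {c u : ι → ℂ} (hc : Summable fun i ↦ ‖c i‖)
    (hre : ∀ i, (c i).re < 0) {p : ℂ} (hp : p ∈ poleSet u) :
    (∑' i, poleCoeff (c i) (u i) p).re < 0 := by
  have hpc : Summable fun i ↦ poleCoeff (c i) (u i) p :=
    Summable.of_norm_bounded hc (fun i ↦ norm_poleCoeff_le _ _ _)
  have hre_sum : Summable fun i ↦ (poleCoeff (c i) (u i) p).re :=
    (Complex.hasSum_re hpc.hasSum).summable
  obtain ⟨i₀, hi₀⟩ := hp.2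
  have hlt : ∑' i, (poleCoeff (c i) (u i) p).re < ∑' _ : ι, (0 : ℝ) :=
    hre_sum.tsum_lt_tsum (fun i ↦ re_poleCoeff_nonpos (hre i) _ _) (re_poleCoeff_neg (hre i₀) hi₀)
      summable_zero
  rw [tsum_zero, ← Complex.re_tsum hpc] at hlt
  exact hlt

/-- **Flux identity.**  If `F` (holomorphic on `𝔻`, equal to `B` on `ball 0 r₀`) and a circle
`sphere p R` (`0 < R ≤ (1 - ‖p‖)/2`) lies in a preconnected `V ∋ 0` inside `𝔻 ∖ closure (poleSet u)`,
then the total charge enclosed by the circle vanishes: `∑' i, discWeight (c i) (u i) p R = 0`. -/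
theorem tsum_discWeight_eq_zero {ι : Type*} [Countable ι] {c u : ι → ℂ}
    (hc : Summable fun i ↦ ‖c i‖) (hu : ∀ i, u i ≠ 0) {F : ℂ → ℂ}
    (hF : DifferentiableOn ℂ F (ball 0 1)) {r₀ : ℝ} (hr₀ : 0 < r₀)
    (hFB : EqOn F (fun z ↦ ∑' i, term (c i) (u i) z) (ball 0 r₀)) {p : ℂ} {R : ℝ} (hR : 0 < R)
    (hRp : R ≤ (1 - ‖p‖) / 2) {V : Set ℂ} (hV : IsPreconnected V) (hV0 : (0 : ℂ) ∈ V)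
    (hVsub : V ⊆ ball 0 1 \ closure (poleSet u)) (hSV : sphere p R ⊆ V) :
    ∑' i, discWeight (c i) (u i) p R = 0 := by
  have hp1 : ‖p‖ < 1 := by linarith
  have hzr : ∀ z ∈ sphere p R, ‖z‖ ≤ ‖p‖ + R := fun z hz ↦ norm_le_of_mem_sphere hz
  have hcb : closedBall p R ⊆ ball (0 : ℂ) 1 := fun z hz ↦ by
    rw [mem_closedBall, dist_eq_norm] at hz
    rw [mem_ball_zero_iff]
    calc ‖z‖ = ‖p + (z - p)‖ := by congr 1; ring
      _ ≤ ‖p‖ + ‖z - p‖ := norm_add_le _ _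
      _ < 1 := by linarith
  -- separation of the circle from the pole set
  have hdisj : Disjoint (sphere p R) (closure (poleSet u)) :=
    Set.disjoint_left.2 fun z hz hzcl ↦ (hVsub (hSV hz)).2 hzcl
  obtain ⟨δ₁, hδ₁, hsep⟩ := exists_separation (isCompact_sphere p R) hdisj
  set δ : ℝ := min δ₁ ((1 - ‖p‖) / 2) with hδ
  have hδ0 : 0 < δ := lt_min hδ₁ (by linarith)
  have hδr : δ ≤ 1 - (‖p‖ + R) := by
    have := min_le_right δ₁ ((1 - ‖p‖) / 2); linarith
  have hfar : ∀ z ∈ sphere p R, ∀ q ∈ poleSet u, δ ≤ ‖q - z‖ :=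
    fun z hz q hq ↦ (min_le_left _ _).trans (hsep z hz q hq)
  have hoff : ∀ q ∈ poleSet u, q ∉ sphere p R := fun q hq hqs ↦ by
    have := hfar _ hqs q hq
    rw [sub_self, norm_zero] at this
    linarith
  -- `∮ B = ∑' ∮ termᵢ`, `∮ termᵢ = -2πi · discWeightᵢ`
  have hsum := hasSum_circleIntegral_borel hc hu hR hδ0 hδr hzr hfar
  have hterm : ∀ i, (∮ z in C(p, R), term (c i) (u i) z) =
      -(2 * π * I) * discWeight (c i) (u i) p R := by
    intro i
    refine circleIntegral_term (hu i) hR hcb (fun h ↦ ?_) (fun h ↦ ?_)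
    · exact hoff _ ⟨mem_ball_zero_iff.1 (hcb (sphere_subset_closedBall h)), i, Or.inl rfl⟩ h
    · exact hoff _ ⟨mem_ball_zero_iff.1 (hcb (sphere_subset_closedBall h)), i, Or.inr rfl⟩ h
  -- `∮ B = ∮ F = 0` (identity theorem on `V`, Cauchy on the closed disc)
  have hFBV := eqOn_of_preconnected hc hu hF hr₀ hFB hV hV0 hVsub
  have hI0 : (∮ z in C(p, R), ∑' i, term (c i) (u i) z) = 0 := by
    rw [← circleIntegral.integral_congr hR.le (hFBV.mono hSV)]
    exact circleIntegral_eq_zero_of_differentiable_on_off_countable hR.le countable_empty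
      (hF.continuousOn.mono hcb)
      (fun z hz ↦ hF.differentiableAt (isOpen_ball.mem_nhds (hcb (ball_subset_closedBall hz.1))))
  have h2 : HasSum (fun i ↦ -(2 * π * I) * discWeight (c i) (u i) p R) 0 := by
    have h := hsum
    simp_rw [hterm] at h
    rwa [hI0] at h
  have h3 : -(2 * π * I) * ∑' i, discWeight (c i) (u i) p R = 0 := by
    rw [← tsum_mul_left]; exact h2.tsum_eq
  have h2pi : -(2 * π * I : ℂ) ≠ 0 := by
    refine neg_ne_zero.2 (mul_ne_zero (mul_ne_zero two_ne_zero ?_) I_ne_zero)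
    exact_mod_cast Real.pi_ne_zero
  exact (mul_eq_zero.1 h3).resolve_left h2pi

/-- **Circles theorem (ζ-free).**  `c` absolutely summable with `Re c_i < 0`, `u_i ≠ 0`, `F` holomorphic
on the unit disc and equal to the Borel series on a disc `ball 0 r₀`.  Then no inside pole `p` is
encircled by arbitrarily small circles `sphere p R` lying in preconnected sets `V ∋ 0` inside
`𝔻 ∖ closure (poleSet u)`. -/
theorem false_of_small_circles {ι : Type*} {c u : ι → ℂ} (hc : Summable fun i ↦ ‖c i‖)
    (hre : ∀ i, (c i).re < 0) (hu : ∀ i, u i ≠ 0) {F : ℂ → ℂ} (hF : DifferentiableOn ℂ F (ball 0 1))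
    {r₀ : ℝ} (hr₀ : 0 < r₀) (hFB : EqOn F (fun z ↦ ∑' i, term (c i) (u i) z) (ball 0 r₀))
    {p : ℂ} (hp : p ∈ poleSet u)
    (hcirc : ∀ δ > 0, ∃ R ∈ Ioo 0 δ, ∃ V : Set ℂ, IsPreconnected V ∧ (0 : ℂ) ∈ V ∧
      V ⊆ ball 0 1 \ closure (poleSet u) ∧ sphere p R ⊆ V) : False := by
  haveI : Countable ι := countable_of_summable_of_re_neg hc hre
  have hp1 : ‖p‖ < 1 := hp.1
  have hp0 : p ≠ 0 := by
    obtain ⟨i, hi | hi⟩ := hp.2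
    · rw [hi]; exact hu i
    · rw [hi]; exact inv_ne_zero (hu i)
  set C : ℂ := ∑' i, poleCoeff (c i) (u i) p with hC
  have hCre : C.re < 0 := re_tsum_poleCoeff_neg hc hre hp
  have hpC : p * C ≠ 0 :=
    mul_ne_zero hp0 fun h ↦ by rw [h, Complex.zero_re] at hCre; exact lt_irrefl _ hCre
  -- the total charge tends to `p · C ≠ 0` …
  have hlim := tendsto_tsum_discWeight u hc hp1
  rw [tsum_mul_left] at hlim
  have hev : ∀ᶠ R in 𝓝[>] (0 : ℝ),
      dist (∑' i, discWeight (c i) (u i) p R) (p * C) < ‖p * C‖ :=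
    Metric.tendsto_nhds.1 hlim _ (norm_pos_iff.2 hpC)
  rw [eventually_nhdsWithin_iff, Metric.eventually_nhds_iff] at hev
  obtain ⟨ε, hε, hevε⟩ := hev
  -- … but it vanishes on a circle of radius `< ε`
  obtain ⟨R, hR, V, hV, hV0, hVsub, hSV⟩ := hcirc (min ε ((1 - ‖p‖) / 2)) (lt_min hε (by linarith))
  have hRε : R < ε := hR.2.trans_le (min_le_left _ _)
  have hRp : R ≤ (1 - ‖p‖) / 2 := (hR.2.trans_le (min_le_right _ _)).le
  have h0 := tsum_discWeight_eq_zero hc hu hF hr₀ hFB hR.1 hRp hV hV0 hVsub hSV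
  have hd : dist R 0 < ε := by rw [Real.dist_eq, sub_zero, abs_of_pos hR.1]; exact hRε
  have := hevε hd hR.1
  rw [h0, dist_comm, dist_zero_right] at this
  exact lt_irrefl _ this

/-! ## 5. Good radii: a set of zero length misses a circle of almost every radius -/

/-- **Good radii.**  If `K ⊆ ℂ` has zero length (`μH[1] K = 0`), then every interval `(a, b)` contains a
radius `t` such that the circle `sphere x t` misses `K` (`z ↦ dist z x` is `1`-Lipschitz and `μH[1] =
volume` on `ℝ`). -/
theorem exists_radius_not_mem {K : Set ℂ} (hK : μH[1] K = 0) (x : ℂ) {a b : ℝ} (hab : a < b) :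
    ∃ t ∈ Ioo a b, ∀ z ∈ K, dist z x ≠ t := by
  have hL : LipschitzWith 1 (fun z : ℂ ↦ dist z x) := LipschitzWith.dist_left x
  have himg : μH[1] ((fun z : ℂ ↦ dist z x) '' K) = 0 := by
    have h := hL.hausdorffMeasure_image_le zero_le_one K
    rw [hK, mul_zero] at h
    exact nonpos_iff_eq_zero.1 h
  have hvol : volume ((fun z : ℂ ↦ dist z x) '' K) = 0 := by
    rw [← hausdorffMeasure_real]; exact himg
  by_contra hcon
  push Not at hcon
  have hsub : Ioo a b ⊆ (fun z : ℂ ↦ dist z x) '' K := by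
    intro t ht
    obtain ⟨z, hz, hzt⟩ := hcon t ht
    exact ⟨z, hz, hzt⟩
  have h0 : volume (Ioo a b) = 0 := measure_mono_null hsub hvol
  rw [Real.volume_Ioo, ENNReal.ofReal_eq_zero] at h0
  linarith

/-- A circle `sphere x ρ` (`x ≠ 0`, `ρ ≥ 0`) contains points of every norm between `|‖x‖ - ρ|` and
`‖x‖ + ρ` (intermediate value theorem on the connected circle). -/
theorem exists_mem_sphere_norm_eq {x : ℂ} (hx : x ≠ 0) {ρ : ℝ} (hρ : 0 ≤ ρ) {R : ℝ}
    (h₁ : |‖x‖ - ρ| ≤ R) (h₂ : R ≤ ‖x‖ + ρ) : ∃ z ∈ sphere x ρ, ‖z‖ = R := by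
  have hxn : 0 < ‖x‖ := norm_pos_iff.2 hx
  have key : ∀ s : ℝ, ‖x * ((s / ‖x‖ : ℝ) : ℂ)‖ = |s| := by
    intro s
    rw [norm_mul, Complex.norm_real, Real.norm_eq_abs, abs_div, abs_of_pos hxn]
    field_simp
  have mem : ∀ s : ℝ, |s - ‖x‖| = ρ → x * ((s / ‖x‖ : ℝ) : ℂ) ∈ sphere x ρ := by
    intro s hs
    rw [mem_sphere, dist_eq_norm]
    have e : x * ((s / ‖x‖ : ℝ) : ℂ) - x = x * (((s - ‖x‖) / ‖x‖ : ℝ) : ℂ) := by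
      have hx' : ((‖x‖ : ℝ) : ℂ) ≠ 0 := by exact_mod_cast hxn.ne'
      push_cast
      field_simp
    rw [e, key, hs]
  have ha : x * (((‖x‖ - ρ) / ‖x‖ : ℝ) : ℂ) ∈ sphere x ρ :=
    mem _ (by rw [show ‖x‖ - ρ - ‖x‖ = -ρ by ring, abs_neg, abs_of_nonneg hρ])
  have hb : x * (((‖x‖ + ρ) / ‖x‖ : ℝ) : ℂ) ∈ sphere x ρ :=
    mem _ (by rw [show ‖x‖ + ρ - ‖x‖ = ρ by ring, abs_of_nonneg hρ])
  have hpre : IsPreconnected (sphere x ρ) :=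
    isPreconnected_sphere (by simp [Complex.rank_real_complex]) x ρ
  have hIcc := hpre.intermediate_value ha hb continuous_norm.continuousOn
  rw [key, key, abs_of_nonneg (by linarith : 0 ≤ ‖x‖ + ρ)] at hIcc
  obtain ⟨z, hz, hzR⟩ := hIcc ⟨h₁, h₂⟩
  exact ⟨z, hz, hzR⟩

/-! ## 6. Thin walls are transparent -/

/-- **Pole walls of zero length are transparent.**  Let `∑ ‖c i‖ < ∞`, `Re (c i) < 0`, `u i ≠ 0`; let `F`
be complex-differentiable on the open unit disc and equal to the Borel series on a disc `ball 0 r₀`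
(`r₀ > 0`) containing no inside pole.  If the closure of the inside pole set has ZERO LENGTH inside the
disc, `μH[1] (closure (poleSet u) ∩ ball 0 1) = 0`, then the inside pole set is empty. -/
theorem poleSet_eq_empty_of_hausdorffMeasure_zero {ι : Type*} {c u : ι → ℂ}
    (hc : Summable fun i ↦ ‖c i‖) (hre : ∀ i, (c i).re < 0) (hu : ∀ i, u i ≠ 0) {F : ℂ → ℂ}
    (hF : DifferentiableOn ℂ F (ball 0 1)) {r₀ : ℝ} (hr₀ : 0 < r₀) (hS : ∀ p ∈ poleSet u, r₀ ≤ ‖p‖)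
    (hFB : EqOn F (fun z ↦ ∑' i, term (c i) (u i) z) (ball 0 r₀))
    (hH : μH[1] (closure (poleSet u) ∩ ball 0 1) = 0) : poleSet u = ∅ := by
  rcases Set.eq_empty_or_nonempty (poleSet u) with h | ⟨p, hp⟩
  · exact h
  exfalso
  refine false_of_small_circles hc hre hu hF hr₀ hFB hp fun δ hδ ↦ ?_
  have hclos : closure (poleSet u) ⊆ {q : ℂ | r₀ ≤ ‖q‖} :=
    closure_minimal (fun q hq ↦ hS q hq) (isClosed_le continuous_const continuous_norm)
  have hp1 : ‖p‖ < 1 := hp.1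
  have hpr : r₀ ≤ ‖p‖ := hS p hp
  have hp0 : p ≠ 0 := fun h ↦ by rw [h, norm_zero] at hpr; linarith
  have hq0 : p / 2 ≠ 0 := div_ne_zero hp0 two_ne_zero
  have hnq : ‖p / 2‖ = ‖p‖ / 2 := by rw [norm_div, RCLike.norm_ofNat]
  have h2 : 1 < Module.rank ℝ ℂ := by simp [Complex.rank_real_complex]
  -- scales
  set r₁ : ℝ := min (r₀ / 2) ((1 - ‖p‖) / 2) with hr₁
  have hr₁0 : 0 < r₁ := lt_min (by linarith) (by linarith)
  have hr₁a : r₁ ≤ r₀ / 2 := min_le_left _ _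
  have hr₁b : r₁ ≤ (1 - ‖p‖) / 2 := min_le_right _ _
  -- a circle avoiding `closure (poleSet u) ∩ 𝔻` and lying in `𝔻` lies in `𝔻 ∖ closure (poleSet u)`
  have hgood : ∀ {x : ℂ} {t : ℝ}, (∀ z ∈ closure (poleSet u) ∩ ball 0 1, dist z x ≠ t) →
      ‖x‖ + t < 1 → sphere x t ⊆ ball 0 1 \ closure (poleSet u) := by
    intro x t ht h1 z hz
    have hz1 : ‖z‖ < 1 := (norm_le_of_mem_sphere hz).trans_lt h1
    exact ⟨mem_ball_zero_iff.2 hz1, fun hzcl ↦ ht z ⟨hzcl, mem_ball_zero_iff.2 hz1⟩ hz⟩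
  -- three good radii: `r` (around `p`), `R` (around `0`), `s` (around `p/2`)
  obtain ⟨r, hr, hgr⟩ := exists_radius_not_mem hH p (lt_min hδ (half_pos hr₁0))
  have hr0 : 0 < r := hr.1
  have hrδ : r < δ := hr.2.trans_le (min_le_left _ _)
  have hrr₁ : r < r₁ / 2 := hr.2.trans_le (min_le_right _ _)
  obtain ⟨R, hR, hgR⟩ := exists_radius_not_mem hH 0 (show ‖p‖ - r < ‖p‖ + r by linarith)
  obtain ⟨s, hs, hgs⟩ :=
    exists_radius_not_mem hH (p / 2) (show ‖p‖ / 2 + r < ‖p‖ / 2 + r₁ by linarith)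
  have hs0 : 0 < s := by linarith [hs.1, norm_nonneg p]
  have hR0 : 0 < R := by linarith [hR.1]
  -- the linking set `V = ball 0 r₁ ∪ sphere (p/2) s ∪ sphere 0 R ∪ sphere p r`
  refine ⟨r, ⟨hr0, hrδ⟩, ball 0 r₁ ∪ sphere (p / 2) s ∪ sphere 0 R ∪ sphere p r, ?_,
    Or.inl (Or.inl (Or.inl (mem_ball_self hr₁0))), ?_, subset_union_right⟩
  · -- preconnected: consecutive pieces meet
    obtain ⟨z₁, hz₁s, hz₁n⟩ := exists_mem_sphere_norm_eq hq0 hs0.le (R := s - ‖p‖ / 2)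
      (by rw [hnq, abs_sub_comm, abs_of_nonneg (by linarith [hs.1])])
      (by rw [hnq]; linarith [norm_nonneg p])
    obtain ⟨z₂, hz₂s, hz₂n⟩ := exists_mem_sphere_norm_eq hq0 hs0.le (R := R)
      (by rw [hnq, abs_sub_comm, abs_of_nonneg (by linarith [hs.1])]; linarith [hs.2, hR.1])
      (by rw [hnq]; linarith [hs.1, hR.2])
    obtain ⟨z₃, hz₃s, hz₃n⟩ := exists_mem_sphere_norm_eq hp0 hr0.le (R := R)
      (by rw [abs_of_nonneg (by linarith)]; exact hR.1.le) hR.2.le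
    have hA : IsPreconnected (ball (0 : ℂ) r₁) := (convex_ball 0 r₁).isPreconnected
    have hAB : IsPreconnected (ball (0 : ℂ) r₁ ∪ sphere (p / 2) s) :=
      IsPreconnected.union' ⟨z₁, mem_ball_zero_iff.2 (by rw [hz₁n]; linarith [hs.2]), hz₁s⟩ hA
        (isPreconnected_sphere h2 _ _)
    have hABC : IsPreconnected (ball (0 : ℂ) r₁ ∪ sphere (p / 2) s ∪ sphere 0 R) :=
      IsPreconnected.union' ⟨z₂, Or.inr hz₂s, mem_sphere_zero_iff_norm.2 hz₂n⟩ hAB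
        (isPreconnected_sphere h2 _ _)
    exact IsPreconnected.union' ⟨z₃, Or.inr (mem_sphere_zero_iff_norm.2 hz₃n), hz₃s⟩ hABC
      (isPreconnected_sphere h2 _ _)
  · -- inside `𝔻 ∖ closure (poleSet u)`
    rintro z (((hz | hz) | hz) | hz)
    · have hzn : ‖z‖ < r₁ := mem_ball_zero_iff.1 hz
      refine ⟨mem_ball_zero_iff.2 (by linarith), fun hzcl ↦ ?_⟩
      have := hclos hzcl
      simp only [mem_setOf_eq] at this
      linarith
    · exact hgood hgs (by rw [hnq]; linarith [hs.2]) hz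
    · exact hgood hgR (by rw [norm_zero, zero_add]; linarith [hR.2]) hz
    · exact hgood hgr (by linarith) hz

/-- Corollary: under the hypotheses of `poleSet_eq_empty_of_hausdorffMeasure_zero`, every `u i` lies ON
the unit circle. -/
theorem norm_eq_one_of_hausdorffMeasure_zero {ι : Type*} {c u : ι → ℂ}
    (hc : Summable fun i ↦ ‖c i‖) (hre : ∀ i, (c i).re < 0) (hu : ∀ i, u i ≠ 0) {F : ℂ → ℂ}
    (hF : DifferentiableOn ℂ F (ball 0 1)) {r₀ : ℝ} (hr₀ : 0 < r₀) (hS : ∀ p ∈ poleSet u, r₀ ≤ ‖p‖)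
    (hFB : EqOn F (fun z ↦ ∑' i, term (c i) (u i) z) (ball 0 r₀))
    (hH : μH[1] (closure (poleSet u) ∩ ball 0 1) = 0) : ∀ i, ‖u i‖ = 1 := by
  have hempty := poleSet_eq_empty_of_hausdorffMeasure_zero hc hre hu hF hr₀ hS hFB hH
  intro i
  by_contra hne
  rcases lt_or_gt_of_ne hne with hlt | hgt
  · have : u i ∈ poleSet u := ⟨hlt, i, Or.inl rfl⟩
    rw [hempty] at this; exact this
  · have hinv : ‖(u i)⁻¹‖ < 1 := by rw [norm_inv]; exact inv_lt_one_of_one_lt₀ hgt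
    have : (u i)⁻¹ ∈ poleSet u := ⟨hinv, i, Or.inr rfl⟩
    rw [hempty] at this; exact this

/-- **The dichotomy** (no hypothesis on the pole set): either there is no inside pole at all, or the
closure of the inside pole set has POSITIVE LENGTH inside the disc. -/
theorem poleSet_empty_or_hausdorffMeasure_pos {ι : Type*} {c u : ι → ℂ}
    (hc : Summable fun i ↦ ‖c i‖) (hre : ∀ i, (c i).re < 0) (hu : ∀ i, u i ≠ 0) {F : ℂ → ℂ}
    (hF : DifferentiableOn ℂ F (ball 0 1)) {r₀ : ℝ} (hr₀ : 0 < r₀) (hS : ∀ p ∈ poleSet u, r₀ ≤ ‖p‖)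
    (hFB : EqOn F (fun z ↦ ∑' i, term (c i) (u i) z) (ball 0 r₀)) :
    poleSet u = ∅ ∨ 0 < μH[1] (closure (poleSet u) ∩ ball 0 1) := by
  by_cases hH : μH[1] (closure (poleSet u) ∩ ball 0 1) = 0
  · exact Or.inl (poleSet_eq_empty_of_hausdorffMeasure_zero hc hre hu hF hr₀ hS hFB hH)
  · exact Or.inr (pos_iff_ne_zero.2 hH)

/-! ## 7. Scales: countable sets and sets of dimension `< 1` have zero length; circles do not -/

/-- Countable sets have zero length (so this module contains `ScrewBorel.poleSet_eq_empty`). -/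
theorem hausdorffMeasure_zero_of_countable {K : Set ℂ} (hK : K.Countable) : μH[1] K = 0 := by
  haveI := MeasureTheory.Measure.nullSingletonClass_hausdorff ℂ one_pos
  exact hK.measure_zero _

/-- Sets of Hausdorff dimension `< 1` have zero length. -/
theorem hausdorffMeasure_zero_of_dimH_lt_one {K : Set ℂ} (hK : dimH K < 1) : μH[1] K = 0 := by
  have h := hausdorffMeasure_of_dimH_lt (d := 1) (s := K) (by exact_mod_cast hK)
  exact_mod_cast h

/-- Dimension form of §6: a pole wall of Hausdorff dimension `< 1` is transparent. -/
theorem poleSet_eq_empty_of_dimH_lt_one {ι : Type*} {c u : ι → ℂ}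
    (hc : Summable fun i ↦ ‖c i‖) (hre : ∀ i, (c i).re < 0) (hu : ∀ i, u i ≠ 0) {F : ℂ → ℂ}
    (hF : DifferentiableOn ℂ F (ball 0 1)) {r₀ : ℝ} (hr₀ : 0 < r₀) (hS : ∀ p ∈ poleSet u, r₀ ≤ ‖p‖)
    (hFB : EqOn F (fun z ↦ ∑' i, term (c i) (u i) z) (ball 0 r₀))
    (hdim : dimH (closure (poleSet u) ∩ ball 0 1) < 1) : poleSet u = ∅ :=
  poleSet_eq_empty_of_hausdorffMeasure_zero hc hre hu hF hr₀ hS hFB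
    (hausdorffMeasure_zero_of_dimH_lt_one hdim)

/-- **Circles are not thin**: a circle of positive radius has positive length (its `1`-Lipschitz shadow
`z ↦ Re (z - x)` covers `[-r, r]`).  A wall containing a circle (e.g. the packing circles of barrier B16's
Wolff configuration) is thus NOT thin. -/
theorem hausdorffMeasure_sphere_pos (x : ℂ) {r : ℝ} (hr : 0 < r) : 0 < μH[1] (sphere x r) := by
  set f : ℂ → ℝ := fun z ↦ (z - x).re with hf
  have hL : LipschitzWith 1 f := by
    refine LipschitzWith.of_dist_le_mul fun a b ↦ ?_
    rw [hf, NNReal.coe_one, one_mul, Real.dist_eq, dist_eq_norm]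
    have e : (a - x).re - (b - x).re = (a - b).re := by simp
    rw [e]
    exact Complex.abs_re_le_norm _
  have hcover : Icc (-r) r ⊆ f '' sphere x r := by
    intro t ht
    refine ⟨x + ⟨t, √(r * r - t * t)⟩, ?_, by simp [hf]⟩
    rw [mem_sphere, dist_eq_norm, add_sub_cancel_left, Complex.norm_def, Complex.normSq_mk,
      Real.mul_self_sqrt (by nlinarith [ht.1, ht.2]), show t * t + (r * r - t * t) = r * r by ring,
      Real.sqrt_mul_self hr.le]
  have h1 : μH[1] (Icc (-r) r) ≤ μH[1] (f '' sphere x r) := measure_mono hcover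
  have h2 : μH[1] (f '' sphere x r) ≤ μH[1] (sphere x r) := by
    have h := hL.hausdorffMeasure_image_le zero_le_one (sphere x r)
    simpa using h
  have h0 : 0 < μH[1] (Icc (-r) r) := by
    rw [hausdorffMeasure_real, Real.volume_Icc]
    have : 0 < r - -r := by linarith
    exact_mod_cast ENNReal.ofReal_pos.2 this
  exact h0.trans_le (h1.trans h2)

end Summit.RiemannHypothesis.RiemannHypothesis.Theorems.Splittings.ScrewBorelFlux
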